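import Literature.IUT.HodgeArakelov.BadPrimeGaussianMonoidsGenuineRecordRestrictionIsoFamily
import Literature.IUT.HodgeArakelov.BadPrimeGaussianMonoidsSplittingOfEvaluationProofs
import Literature.IUT.HodgeArakelov.ThetaEnvDataRecordRoots

/-!
# [IUTchII] Prop 3.1 (i) «splittings up to torsion» AT THE GENUINE `θ_env` DATA of `X̲̲_K` over `ℚ̄_pˣ` (any inversion
# family): the typed clause `Prop31Statements.splitting` at a label DERIVED from `horb`, `htors` and the theta EVALUATION (E)

S. Mochizuki, *Inter-universal Teichmüller theory II*, kurims Dec-2020 manuscript, Prop 3.1 (i) p. 87 ("a functorial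
algorithm for constructing the splittings up to torsion determined by the subsets `M^×_TM(M^Θ_*)`, `θ^ι_env(M^Θ_*)`,
`∞θ^ι_env(M^Θ_*)`"), Cor 3.5 (i)/(ii) pp. 94–95 [cite: Mochizuki2012, Prop 3.1 (i) p.87]. Claim key DISPUTED (D-0012).
PROOF-ONLY companion (abc-iut cell, layer L6, seat abc-iut-w4-d004 gen 3; node **IUTchII:Prop3.1(i)** splitting clause,
sub-DAG row P31.i.r4 / junction J3; and IUTchII:Cor3.5(ii)). NO definition, NO `Prop` fact, NO instance.

ASSEMBLY of this seat's `isSplittingUpToTorsion_{thetaEnv,inftyThetaEnv}_of_eval` (`…SplittingOfEvaluationProofs`) at the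
record `(EtaleLevels.thetaEnvData …).toRecord (h1LimConjMulAut …) (h1LimKummerOn c hA hfi O) iota` over `A = ℚ̄_pˣ`
(abc-iut-w4-d019's bridge over abc-iut-w4-d030's genuine `θ_env` data; ANY family `iota` of inversion actions), with
(K) = abc-iut-w4-d007's Kummer injectivity theorems (`hκ_padic`, `hκ₀_padic`), (R) = `hRκ_toRecord` (Kummer naturality,
this seat), and the sharp root condition = abc-iut-w5-d192's `exists_pow_eq_unit_mul_of_mem_toRecord_inftyThetaEnv'`
(from `horb` + `htors`):
* **`splitting_toRecord_padic_of_eval`** — `IsSplittingUpToTorsion M^×_TM ⟨∞θ^{i₀}_env⟩ ∧ IsSplittingUpToTorsion M^×_TM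
  ⟨θ^{i₀}_env⟩` at the genuine data. Inputs: ONE continuous evaluation section `s_{t₀}` into `Π^tp_{Ÿ̲̲}` with coefficient
  action `φ₀` and finite-index `ε`-image, `G_v` acting on `ℚ̄_pˣ` as through it; the model data (`c`, `c₀` bijective,
  `c₀.hom = c.hom`; the constant monoid `O`); `horb`; `htors` (`M^μ_TM ⊆ M^×_TM` — a theorem at the genuine data for
  `O ⊇ μ`: abc-iut-w4-d004 p423317 / abc-iut-w5-d192 `…OfTower`); and **(E) at the single label `t₀`:
  `R_{t₀} θ = κ₀ q` with `q ∈ O` a NON-UNIT** (Cor 2.8 (i) / [EtTh] Prop 1.4 (iii); Rmk 2.5.1 (i)). So the junction J3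
  («divisor map», [EtTh] Prop 1.4 «ord Θ > 0») of the sub-DAG is ABSORBED into (E).
Nothing here asserts a disputed claim or takes a side on [IUTchIII] Cor 3.12; typed ≠ proved ≠ endorsed.
-/

noncomputable section

namespace Literature.IUT.HodgeArakelov

namespace EtaleLevels

open Literature.AnabelianGeometry.EtaleTheta CohomologySystemOfContH1 EtaleThetaDataOfSetting TemperedThetaMonoids
  BadPrimeGaussianMonoids

variable {p : ℕ} [Fact p.Prime] {D : Literature.AnabelianGeometry.EtaleTheta.ThetaSetting p}
  {E : D.EtaleThetaData} {l : ℕ} (C : E.DoubleUnderline l) (hC : D.Compat) (hS : D.Sec2Hyps)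
  (hl : l.Prime) (hp2 : p ≠ 2) (hpl : p ≠ l) (hζ : ∃ ζ : D.K, IsPrimitiveRoot ζ (4 * l))
  (mods : ∀ M : ℕ+, D.CyclotomeMod l M)
  (f : contCocycles D.toTheta D.DeltaTheta C.GtpYdduu) (hf : f ∈ C.rootCocycles hC)
  (hmods : ∀ (M M' : ℕ+) (h : (M : ℕ) ∣ (M' : ℕ)) (x : D.lDeltaTheta l),
    MuN.red p M M' h ((mods M').red x) = (mods M).red x)
  (h15 : Literature.AnabelianGeometry.EtaleTheta.ThetaSetting.Prop15iii E hC) (L : C.CuspLabels)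
  (hZ : ∀ M : ℕ+, Nonempty (ModelCyclotomes.lDeltaQuot (C.rigidData (mods M) hC hS h15 L) ≃*
    Literature.IUT.HodgeTheaters.ZHat))
  (hcharY : EtaleThetaDataOfSetting.PiYddCharacteristic C)
  (hlim : Function.Bijective (rigidLimHom C hC hS hl hp2 hpl hζ mods f hf hmods h15 L hZ))
  [(EtaleThetaDataOfSetting.PiYdd C).Normal]
  {Iota : Type}
  (iota : Iota → ((thetaEnvData C hC hS hl hp2 hpl hζ mods f hf hmods h15 L hZ hcharY hlim).D.coh.lim ≃+
    (thetaEnvData C hC hS hl hp2 hpl hζ mods f hf hmods h15 L hZ hcharY hlim).D.coh.lim))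
  {P₀ : TopGroup.{0}} (φ₀ : P₀ →* D.GtpTheta) (s₀ : P₀ →* Pi C)
  (hι : Continuous ((MonoidHom.id (Pi C)).comp s₀))
  (hN : (⊤ : Subgroup P₀).map ((MonoidHom.id (Pi C)).comp s₀) ≤ PiYdd C)
  (hφ : (phi C).comp ((MonoidHom.id (Pi C)).comp s₀) = φ₀)
  [TopologicalSpace (PadicAlgCl p)ˣ]
  (c : CyclotomeCoefficients (phi C) (D.lDeltaTheta l) (PadicAlgCl p)ˣ)
  (hA : ∀ b : (PadicAlgCl p)ˣ, IsOpen (MulAction.stabilizer (Pi C) b : Set (Pi C)))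
  (hfi : ∀ b : (PadicAlgCl p)ˣ, (MulAction.stabilizer (Pi C) b).FiniteIndex)
  (O : Submonoid (PadicAlgCl p)ˣ)
  [MulDistribMulAction P₀ (PadicAlgCl p)ˣ]
  (c₀ : CyclotomeCoefficients φ₀ (D.lDeltaTheta l) (PadicAlgCl p)ˣ)
  (hA₀ : ∀ b : (PadicAlgCl p)ˣ, IsOpen (MulAction.stabilizer P₀ b : Set P₀))
  (hfi₀ : ∀ b : (PadicAlgCl p)ˣ, (MulAction.stabilizer P₀ b).FiniteIndex)

/-- **[IUTchII] Prop 3.1 (i) «splittings up to torsion» AT THE GENUINE `θ_env` DATA over `ℚ̄_pˣ`** (any inversion family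
`iota`, label `i₀`): the typed clause `IsSplittingUpToTorsion M^×_TM ⟨∞θ^{i₀}_env⟩` (= `Prop31Statements.splitting i₀`) AND
`IsSplittingUpToTorsion M^×_TM ⟨θ^{i₀}_env⟩` hold for the record `(thetaEnvData …).toRecord (h1LimConjMulAut …)
(h1LimKummerOn c hA hfi O) iota`, from: ONE continuous evaluation section `s₀ : G_v → Π^tp_{X̲̲}` into `Π^tp_{Ÿ̲̲}` with
coefficient action `φ₀` and finite-index `ε`-image, `G_v` acting on `ℚ̄_pˣ` as through it; `c`, `c₀` bijective with the same
underlying homomorphism; `horb`; `htors`; and (E) `R₀ θ = κ₀ q` for the restriction `R₀ = h1LimCongr ∘ s₀^*` with `q ∈ O` a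
NON-UNIT. (K) and (R) are DERIVED (abc-iut-w4-d007 / abc-iut-w4-d004). [cite: Mochizuki2012, Prop 3.1 (i) p.87] -/
theorem splitting_toRecord_padic_of_eval (hc : Function.Bijective c.hom)
    (hc₀ : Function.Bijective c₀.hom) (hc₀c : ∀ ζ, c₀.hom ζ = c.hom ζ)
    (hact : ∀ (g : P₀) (a : (PadicAlgCl p)ˣ), g • a = s₀ g • a)
    [((EtaleThetaDataOfSetting.aug C).comp s₀).range.FiniteIndex]
    {i₀ : Iota}
    {θ : ((thetaEnvData C hC hS hl hp2 hpl hζ mods f hf hmods h15 L hZ hcharY hlim).toRecord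
        (h1LimConjMulAut (phi C) (D.lDeltaTheta l) (PiYdd C))
        (h1LimKummerOn (phi C) (D.lDeltaTheta l) (PiYdd C) c hA hfi O) iota).H}
    (hθ : θ ∈ ((thetaEnvData C hC hS hl hp2 hpl hζ mods f hf hmods h15 L hZ hcharY hlim).toRecord
        (h1LimConjMulAut (phi C) (D.lDeltaTheta l) (PiYdd C))
        (h1LimKummerOn (phi C) (D.lDeltaTheta l) (PiYdd C) c hA hfi O) iota).thetaEnv i₀)
    (horb : ∀ θ' ∈ ((thetaEnvData C hC hS hl hp2 hpl hζ mods f hf hmods h15 L hZ hcharY hlim).toRecord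
        (h1LimConjMulAut (phi C) (D.lDeltaTheta l) (PiYdd C))
        (h1LimKummerOn (phi C) (D.lDeltaTheta l) (PiYdd C) c hA hfi O) iota).thetaEnv i₀,
      ∃ u ∈ ((thetaEnvData C hC hS hl hp2 hpl hζ mods f hf hmods h15 L hZ hcharY hlim).toRecord
        (h1LimConjMulAut (phi C) (D.lDeltaTheta l) (PiYdd C))
        (h1LimKummerOn (phi C) (D.lDeltaTheta l) (PiYdd C) c hA hfi O) iota).units, θ' = u * θ)
    (htors : ∀ u : ((thetaEnvData C hC hS hl hp2 hpl hζ mods f hf hmods h15 L hZ hcharY hlim).toRecord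
        (h1LimConjMulAut (phi C) (D.lDeltaTheta l) (PiYdd C))
        (h1LimKummerOn (phi C) (D.lDeltaTheta l) (PiYdd C) c hA hfi O) iota).H,
      IsOfFinOrder u → u ∈ ((thetaEnvData C hC hS hl hp2 hpl hζ mods f hf hmods h15 L hZ hcharY hlim).toRecord
        (h1LimConjMulAut (phi C) (D.lDeltaTheta l) (PiYdd C))
        (h1LimKummerOn (phi C) (D.lDeltaTheta l) (PiYdd C) c hA hfi O) iota).units)
    (R₀ : ((thetaEnvData C hC hS hl hp2 hpl hζ mods f hf hmods h15 L hZ hcharY hlim).toRecord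
        (h1LimConjMulAut (phi C) (D.lDeltaTheta l) (PiYdd C))
        (h1LimKummerOn (phi C) (D.lDeltaTheta l) (PiYdd C) c hA hfi O) iota).H →*
      Multiplicative (h1Lim φ₀ (D.lDeltaTheta l) (⊤ : Subgroup P₀) ⊥))
    (hR₀ : ∀ y, Multiplicative.toAdd (R₀ y) =
      h1LimCongr (D.lDeltaTheta l) ⊤ hφ ⊥
        (h1LimComap (phi C) (D.lDeltaTheta l) ((MonoidHom.id (Pi C)).comp s₀) hι hN
          (AddEquiv.additiveMultiplicative (h1Lim (phi C) (D.lDeltaTheta l) (PiYdd C) ⊥) (Additive.ofMul y))))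
    (q : O) (hRθ : R₀ θ = h1LimKummerOn φ₀ (D.lDeltaTheta l) ⊤ c₀ hA₀ hfi₀ O q) (hq : ¬ IsUnit q) :
    IsSplittingUpToTorsion
        ((thetaEnvData C hC hS hl hp2 hpl hζ mods f hf hmods h15 L hZ hcharY hlim).toRecord
          (h1LimConjMulAut (phi C) (D.lDeltaTheta l) (PiYdd C))
          (h1LimKummerOn (phi C) (D.lDeltaTheta l) (PiYdd C) c hA hfi O) iota).units
        (Submonoid.closure (((thetaEnvData C hC hS hl hp2 hpl hζ mods f hf hmods h15 L hZ hcharY hlim).toRecord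
          (h1LimConjMulAut (phi C) (D.lDeltaTheta l) (PiYdd C))
          (h1LimKummerOn (phi C) (D.lDeltaTheta l) (PiYdd C) c hA hfi O) iota).inftyThetaEnv i₀)) ∧
      IsSplittingUpToTorsion
        ((thetaEnvData C hC hS hl hp2 hpl hζ mods f hf hmods h15 L hZ hcharY hlim).toRecord
          (h1LimConjMulAut (phi C) (D.lDeltaTheta l) (PiYdd C))
          (h1LimKummerOn (phi C) (D.lDeltaTheta l) (PiYdd C) c hA hfi O) iota).units
        (Submonoid.closure (((thetaEnvData C hC hS hl hp2 hpl hζ mods f hf hmods h15 L hZ hcharY hlim).toRecord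
          (h1LimConjMulAut (phi C) (D.lDeltaTheta l) (PiYdd C))
          (h1LimKummerOn (phi C) (D.lDeltaTheta l) (PiYdd C) c hA hfi O) iota).thetaEnv i₀)) := by
  haveI := ‹((EtaleThetaDataOfSetting.aug C).comp s₀).range.FiniteIndex›
  -- (K): both Kummer maps injective at `ℚ̄_pˣ`
  have hκ := hκ_padic C c hA hfi O hc
  have hκ₀ : Function.Injective (h1LimKummerOn φ₀ (D.lDeltaTheta l) ⊤ c₀ hA₀ hfi₀ O) :=
    hκ₀_padic (C := C) (O := O) (φ₀ := φ₀) (s := fun _ : Unit => s₀) (hι := fun _ => hι) (c₀ := c₀) (hA₀ := hA₀)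
      (hfi₀ := hfi₀) hc₀ () hact
  -- (R): restriction of constants along `s₀`, in the `hRκ` shape
  have hRκ : ∀ (m : O)
      (hm : h1LimKummerOn (phi C) (D.lDeltaTheta l) (PiYdd C) c hA hfi O m ∈
        ((thetaEnvData C hC hS hl hp2 hpl hζ mods f hf hmods h15 L hZ hcharY hlim).toRecord
          (h1LimConjMulAut (phi C) (D.lDeltaTheta l) (PiYdd C))
          (h1LimKummerOn (phi C) (D.lDeltaTheta l) (PiYdd C) c hA hfi O) iota).thetaMonoid i₀),
      (R₀.comp (((thetaEnvData C hC hS hl hp2 hpl hζ mods f hf hmods h15 L hZ hcharY hlim).toRecord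
          (h1LimConjMulAut (phi C) (D.lDeltaTheta l) (PiYdd C))
          (h1LimKummerOn (phi C) (D.lDeltaTheta l) (PiYdd C) c hA hfi O) iota).thetaMonoid i₀).subtype)
          ⟨h1LimKummerOn (phi C) (D.lDeltaTheta l) (PiYdd C) c hA hfi O m, hm⟩ =
        h1LimKummerOn φ₀ (D.lDeltaTheta l) ⊤ c₀ hA₀ hfi₀ O m := fun m hm =>
    hRκ_toRecord C hC hS hl hp2 hpl hζ mods f hf hmods h15 L hZ hcharY hlim iota φ₀ (fun _ : Unit => s₀)
      (fun _ => hι) (fun _ => hN) (fun _ => hφ) c hA hfi O c₀ hA₀ hfi₀ hc₀c (fun _ g a => hact g a) (fun _ => R₀)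
      (fun _ y => hR₀ y) () m hm
  -- the sharp root condition (abc-iut-w5-d192) from `horb` + `htors`
  have hrootsθ : ∀ ϑ ∈ ((thetaEnvData C hC hS hl hp2 hpl hζ mods f hf hmods h15 L hZ hcharY hlim).toRecord
        (h1LimConjMulAut (phi C) (D.lDeltaTheta l) (PiYdd C))
        (h1LimKummerOn (phi C) (D.lDeltaTheta l) (PiYdd C) c hA hfi O) iota).inftyThetaEnv i₀,
      ∃ N : ℕ, 0 < N ∧ ∃ v ∈ ((thetaEnvData C hC hS hl hp2 hpl hζ mods f hf hmods h15 L hZ hcharY hlim).toRecord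
        (h1LimConjMulAut (phi C) (D.lDeltaTheta l) (PiYdd C))
        (h1LimKummerOn (phi C) (D.lDeltaTheta l) (PiYdd C) c hA hfi O) iota).units, ϑ ^ N = v * θ := by
    intro ϑ hϑ
    obtain ⟨N, hN, v, hv, hvθ⟩ :=
      ThetaEnvData.exists_pow_eq_unit_mul_of_mem_toRecord_inftyThetaEnv'
        (thetaEnvData C hC hS hl hp2 hpl hζ mods f hf hmods h15 L hZ hcharY hlim)
        (h1LimConjMulAut (phi C) (D.lDeltaTheta l) (PiYdd C))
        (h1LimKummerOn (phi C) (D.lDeltaTheta l) (PiYdd C) c hA hfi O) iota i₀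
        (fun θ' hθ' => by
          obtain ⟨u, hu, h⟩ := horb θ' hθ'
          exact ⟨u, hu, h⟩)
        (fun u hu => htors u hu) hϑ
    exact ⟨N, hN, v, hv, hvθ⟩
  exact ⟨isSplittingUpToTorsion_inftyThetaEnv_of_eval _
      (h1LimKummerOn (phi C) (D.lDeltaTheta l) (PiYdd C) c hA hfi O)
      (h1LimKummerOn φ₀ (D.lDeltaTheta l) ⊤ c₀ hA₀ hfi₀ O)
      (R₀.comp (((thetaEnvData C hC hS hl hp2 hpl hζ mods f hf hmods h15 L hZ hcharY hlim).toRecord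
          (h1LimConjMulAut (phi C) (D.lDeltaTheta l) (PiYdd C))
          (h1LimKummerOn (phi C) (D.lDeltaTheta l) (PiYdd C) c hA hfi O) iota).thetaMonoid i₀).subtype) q hκ
      (ThetaEnvData.toRecord_constantMonoid _ _ _ _) hθ hrootsθ hRκ hRθ hκ₀ hq,
    isSplittingUpToTorsion_thetaEnv_of_eval _
      (h1LimKummerOn (phi C) (D.lDeltaTheta l) (PiYdd C) c hA hfi O)
      (h1LimKummerOn φ₀ (D.lDeltaTheta l) ⊤ c₀ hA₀ hfi₀ O)
      (R₀.comp (((thetaEnvData C hC hS hl hp2 hpl hζ mods f hf hmods h15 L hZ hcharY hlim).toRecord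
          (h1LimConjMulAut (phi C) (D.lDeltaTheta l) (PiYdd C))
          (h1LimKummerOn (phi C) (D.lDeltaTheta l) (PiYdd C) c hA hfi O) iota).thetaMonoid i₀).subtype) q hκ
      (ThetaEnvData.toRecord_constantMonoid _ _ _ _) hθ horb hRκ hRθ hκ₀ hq⟩

end EtaleLevels

end Literature.IUT.HodgeArakelov

end
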